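import Mathlib
import Literature.MathematicalPhysics.QuantumFieldTheory.Balaban1983to89.B11SectG

/-!
# `Balaban1983to89.B11Ineq189` — [Balaban1985Variational] p. 308, inequality (189): the author-omitted estimate of the
kernel (δ²/δA′²)V(A′), SUPPLIED as a term census over the majorant calculus of `…B11SectG`, with the one intermediate
that is NOT in print — the second functional derivative of D(A′) of (44), (65)–(73) — LOCATED and its shape
KERNEL-CHECKED (`d2D_shape`, `d2D_hasMaj₂`), and the assembly "finite sum of terms, each of majorant θᵢe^{−ρᵢd},
ρᵢ ≥ ¼δ₀ ⇒ (189)" KERNEL-CHECKED (`ineq189_of_terms`, `HasMaj₂.apply_bounded_exp`).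

FRAMING (verbatim cell line; v1.3 DOCFIX, referee asks ref-2 N1 / ref-3 N-g23-2 — it was missing from v1–v1.2; no
declaration changed):
statement-level skeleton of published theorems with citation tags; proofs where landed; nothing here is a claim about the Yang–Mills mass gap

CITATION HEADER (lean-in-tree rule 2026-08-18).  Source: T. Bałaban, *The variational problem and background fields in
renormalization group method for lattice gauge theories*, Commun. Math. Phys. **102**, 277–309 (1985),
doi:10.1007/bf01229381 (cell paper B11; held `paper:balaban1985-cmp102-variational-background`; journal page = PDF page
+ 276; quotations read from the page renders pp. 284–293, 307–308 [PDF 8–17, 31–32],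
`b2b-balaban-ref1/pages/1985-cmp102-variational-background/…-p008…p017,p031,p032-x2.png`).  References of the paper used
here: [3] = [Balaban1984PropagatorsII] (Lemma 2.1, (2.54); sibling modules `…B6`, `…B6RandomWalk`), [4] =
[Balaban1985Averaging] (Props 4, 5, 7; sibling module `…B7`, `B7.Prop4Printed`, `B7.Prop5Printed`, `B7.Prop7Printed`),
[5] = [Balaban1985BackgroundPropagators] (Thm 3.12, (3.132)–(3.133); sibling module `…B9`, `B9.Ineq3132`, `B9.Ineq3133`).
This module only IMPORTS `…B11SectG` (gen 2; `BlockNorm`, `HasMaj`, `RowSum`, `conv_exp_le`, `Ineq189`) and modifies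
nothing there.

THE PRINTED TARGET (p. 308 [PDF 32], verbatim): *"|Δ(y)((δ²/δA′²)V)(A′)𝔄| ≤ O(1)ε₃(L^jη)^{−3}exp(−¼δ₀d(y,y′))
max{|𝔄|_{(−1)}, |∇𝔄|_{(−2)}}, (189) for supp 𝔄 ⊂ Δ̃(y′), A′ satisfying (77), y ∈ Λ_j."* — typed (gen 2) as
`B11SectG.Ineq189 bN b3 W θW δ₀ := HasMaj bN b3 W (fun y y′ ↦ θW·e^{−(δ₀/4)d(y,y′)})`.  The author's words around it
(p. 308): *"To prove an exponential decay we have to investigate more closely the kernel ((δ²/δA′²)V)(A′). This is,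
unfortunately, a very awkward and complicated problem, although quite straightforward. Already the first derivative of
V is complicated and given by many formulas, see (85), (88), (89), (90), (93). Now we have to differentiate those
expressions second time. We do not perform these calculations here, we have obtained all necessary results to do the
calculations and estimates, let us formulate a final result only"* (the term census below covers the superset (85),
(88)–(96) of the displays the author names — our bookkeeping, not his list); and p. 307: *"We will prove that this
derivative has regularity and decay properties identical to the propagator H, or H₀. The proof will be similar to the
proof of the decay property (73) for the derivative (δ/δA′)D(A′)."* (v1.1, DOCFIX GAPS G-pv14-2: five passages of v1
set in quotation marks were paraphrases; they are replaced here by the printed words, re-read from the renders p. 289,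
291, 307, 308 [PDF 13, 15, 31, 32] and [4] p. 38 [PDF 22]; no declaration changed).

WHAT IS REPRODUCED.
(a) A majorant vocabulary for 𝔄-DEPENDENT operator families (`HasMaj₂`): a bilinear T : 𝔄, μ ↦ T𝔄μ has majorant
K(y, y″, y′) when *"the size of T𝔄μ near y is ≤ K(y,y″,y′) × (size of μ, localised near y″) × (size of 𝔄, localised
near y′)"* — the shape in which every second-derivative term of V enters: 𝔄 is the direction of differentiation
(supp 𝔄 ⊂ Δ̃(y′) in (189)), μ the argument the differentiated operator acts on.  KERNEL-CHECKED [folklore]: the algebra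
`HasMaj₂.mono/congr/add/neg/sub`, contraction against a bounded argument (`apply_bounded`, `apply_bounded_exp` — how
a differentiated operator applied to a FIXED bounded configuration such as (L^jη)⁻¹(QGQ*)⁻¹QA′ of (88) or the current
⟨·, HᵀJ⟩ of (85) becomes an ordinary majorant in 𝔄), post-composition with a fixed operator (`postcomp`,
`postcomp_exp`, using the three-factor convolution `conv_exp_le₃` = (2.54) [3] twice + the row sum (2.61) of Lemma 2.1
[3]), pre-composition in either slot (`precomp₂`, `precomp₁`, `…_exp` via `B11SectG.conv_exp_le`), and the LOCAL
BILINEAR LEAF (`hasMaj₂_local`: a family with loc_y(T𝔄μ) ≤ β·loc_y μ·loc_y 𝔄 — the second A-derivative of a local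
analytic functional such as C_k(U₀, A) of [4] Prop. 4, p. 38: *"There exist constants C₂, c₄ such that for α₀, α₁ ≤ c₄
the function Q_k(U₀, ηA, c) = (1/i) log(Ū₁^k)_c, c ⊂ Ω^{(k)}, is an analytic function of the variables A_b, b
⊂ B^k(c₋)∪B^k(c₊). Further we have Q_k(U₀, ηA) = Q_k(U₀)A + C_k(U₀, A), (134) and |C_k(U₀, A)| ≤ C₂|A|² < C₂α₁². (135)"*,
differentiated twice by the Cauchy formula on the polydisc of the hypothesis α₁ ≤ c₄ with (128)–(129), or V₀′(A, ∂p)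
of (39)–(40) with p. 291: *"The derivative ((∂/∂A(b))V₀′)(A, ∂p) satisfies a bound similar to the bound (40) for the
function V₀′(A, ∂p), but with the power of |A| lower by 1, and with a different absolute constant."* — has the majorant
β·a·a′·e^{−ρd(y,y″)}e^{−ρ′d(y,y′)} given the identity-localities of the two sizes).
(b) KERNEL-CHECKED, the LOCATED UNPRINTED INTERMEDIATE in its exact shape (`d2D_shape`, `d2D_hasMaj₂`): differentiating
the defining equation (68) of 𝔇(A′) = (δ/δA′)D(A′), *"{I + L^jη⟨(δ/δA)C_j(L^jη(A′ − HD(A′))), H⟩}𝔇(A′) =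
L^jη(δ/δA)C_j(L^jη(A′ − HD(A′)))"* (68), once more in the direction 𝔄 gives [I + ℜ(A′)]δ𝔇[𝔄] = L^jη(δ²C_j/δA²)(·)
[(I − H𝔇)·, (I − H𝔇)𝔄]|_{restricted} − L^jη⟨(δ²C_j/δA²)(·)[H𝔇 ·, (I − H𝔇)𝔄], ·⟩ — two terms of the shape
S(Φ(U′𝔄)(Rμ)) with S = (I + ℜ)⁻¹ of majorant 2e^{−½δ₀d} ((71), p. 289: *"|(I + ℜ)⁻¹(c, c′)| ≤ (1 − 9C₂B₀ε₃dc₁(½))⁻¹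
(L^{j′}η)^{−d}e^{−(1/2)δ₀d(c₋,c′₋)} ≤ 2(L^{j′}η)^{−d}e^{−(1/2)δ₀d(c₋,c′₋)} (71) for ε₃ sufficiently small, which follows
from Lemma 2.1 [3]"*; block labels c₋, c′₋),
Φ local (the second derivative of L^jηC_j, [4] Prop. 4 + Cauchy), U′ = I − H𝔇 and R ∈ {restriction, H𝔇} of
majorants ≤ O(1)e^{−½δ₀d} ((46) + [5] Thm 3.12 for H — used in print at the rate δ₀ in (69), (86); (73) for 𝔇:
*"|𝔇(A′; c, b)| ≤ O(1)C₃ε₃(L^jη)^{−d+1}exp(−½δ₀d(c₋, y)), b ∈ B^j(y)"*).  RESULT: δ𝔇 = (δ²/δA′²)D has the majorant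
θ·e^{−⅛δ₀d(y,y″)}e^{−¼δ₀d(y,y′)} — JOINT decay whose exponents must satisfy ρ + ρ′ + σ ≤ ½δ₀ (σ = the rate at which
Lemma 2.1 is summed), which is WHY (189) carries ¼δ₀ and not the ½δ₀ of (73): the terms of (δ²/δA′²)V linear in 𝔇
keep ½δ₀, the terms containing δ𝔇 (from A = A′ − HD(A′) differentiated twice: (85) via 𝔇₂ = δD₂/δA′, the third term
of (88) via 𝔇*, every "A″ = A′ − HD(A′)"-dressed local polynomial (89)–(96)) are capped at ½δ₀ − (rate of the
μ-contraction) − σ = ¼δ₀ with σ = ⅛δ₀.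
(c) KERNEL-CHECKED, the assembly (`ineq189_of_terms`): (δ²/δA′²)V(A′) = a finite sum of terms W_i, each with a
majorant θ_i e^{−ρ_i d}, ρ_i ≥ ¼δ₀ ⇒ `Ineq189 bN b3 W (Σθ_i) δ₀`; the ε-BOOKKEEPING θ_i ≤ O(1)ε₃(L^jη)^{−3} is the
column "size" of the census table in the companion note `b2b-balaban-b11/SECOND-DERIVATIVE-189.md` (every θ_i is a
product of printed constants: O(1)C₃ε₃ of (73), 2 of (71), O(1) of (3.132)–(3.133) [5], C₂ of [4] (134), the bounds
(52)–(55), (77); the scale weights (L^jη)^{−1,−2,−3} live inside the local sizes as in `…B11SectG`).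
WHAT IS *NOT* REPRODUCED OR ASSERTED: the analytic leaves themselves (existence and analyticity of D(A′) (44)–(56), the
bounds (71)–(73), [4] Props 4–7, [5] Thm 3.12) — hypotheses of the printed shapes; the identification of the abstract
families with the concrete second derivatives (the term census is PROSE, `SECOND-DERIVATIVE-189.md` §5, one row per
printed term of (85), (88)–(96)); the exchange of the scale factors (L^{j′}η)^{−3} ↔ (L^jη)^{−3} between the output
and input localisation scales (routine by [3] Lemma 2.1 (2.60), recorded, not typed); the transport *"finally Proposition
2 and (181)"* (cell GAPS G-B11-G2a, second half).  VERDICT CARRIED BY THIS MODULE: (189) is DERIVABLE from the printed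
Sect. D material at the paper's own standard of rigour; the sentence *"we have obtained all necessary results"* is
accurate for every leaf EXCEPT the second derivative of D, which is printed nowhere in the series and is supplied here
(shape kernel-checked, constants prose) — a located omission, not an error.  NOTHING of the series is asserted; value =
typed skeleton + located gap + kernel-checked bookkeeping, NOT summit progress.  Unit `b2b-balaban-b11-g3` (paper
sub-cell B11, gen 3); companion rows: cell `GAPS.md` G-B11-G2, G-B11-G2a (sharpened), `DIVERGENCE.md` D-B11-10,
`b2b-balaban-b11/SECOND-DERIVATIVE-189.md`, `b2b-balaban-b11/B11.md` §G2.
-/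

namespace Literature.MathematicalPhysics.QuantumFieldTheory.Balaban1983to89.B11Ineq189

open Literature.MathematicalPhysics.QuantumFieldTheory.Balaban1983to89
open Finset B6RandomWalk B11SectG

variable {g : B6.Geometry}
variable {FA FA' F₀ F₁ F₂ F₃ : Type} [AddCommGroup FA] [Module ℝ FA] [AddCommGroup FA'] [Module ℝ FA']
  [AddCommGroup F₀] [Module ℝ F₀] [AddCommGroup F₁] [Module ℝ F₁] [AddCommGroup F₂] [Module ℝ F₂]
  [AddCommGroup F₃] [Module ℝ F₃]

/-! ## Three-factor convolution of exponential kernels ((2.54) twice + (2.61) of [3]) -/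

/-- Σ_z e^{−ρ_S d(y,z)}·e^{−ρd(z,y″)}·e^{−ρ′d(z,y′)} ≤ c·e^{−ρ₃d(y,y″)}·e^{−ρ₃′d(y,y′)} whenever ρ₃ ≤ ρ, ρ₃′ ≤ ρ′ and
ρ₃ + ρ₃′ + σ ≤ ρ_S, with Σ_z e^{−σd(y,z)} ≤ c: the triangle inequality (2.54) [3] applied to d(y,y″) and to d(y,y′),
then the row sum of Lemma 2.1 [3].  This is the bookkeeping behind a JOINTLY decaying kernel composed with a decaying
operator — the step that caps the rate of (189) at ¼δ₀. [cite: Balaban1984PropagatorsII, (2.54) p.233 + Lemma 2.1 p.234] -/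
theorem conv_exp_le₃ {ρS ρ ρ' ρ₃ ρ₃' σ c : ℝ} (htri : Triangle254 g) (hd : ∀ a b : g.Site, 0 ≤ g.dist a b)
    (hrow : RowSum g σ c) (hρ₃ : 0 ≤ ρ₃) (hρ₃' : 0 ≤ ρ₃') (h1 : ρ₃ ≤ ρ) (h2 : ρ₃' ≤ ρ') (h3 : ρ₃ + ρ₃' + σ ≤ ρS)
    (y y'' y' : g.Site) :
    ∑ z : g.Site, Real.exp (-(ρS * g.dist y z)) *
        (Real.exp (-(ρ * g.dist z y'')) * Real.exp (-(ρ' * g.dist z y'))) ≤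
      c * (Real.exp (-(ρ₃ * g.dist y y'')) * Real.exp (-(ρ₃' * g.dist y y'))) := by
  have hterm : ∀ z : g.Site,
      Real.exp (-(ρS * g.dist y z)) * (Real.exp (-(ρ * g.dist z y'')) * Real.exp (-(ρ' * g.dist z y'))) ≤
        Real.exp (-(σ * g.dist y z)) * (Real.exp (-(ρ₃ * g.dist y y'')) * Real.exp (-(ρ₃' * g.dist y y'))) := by
    intro z
    rw [← Real.exp_add, ← Real.exp_add, ← Real.exp_add, ← Real.exp_add]
    refine Real.exp_le_exp.mpr ?_
    have t1 := htri y z y''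
    have t2 := htri y z y'
    have e1 : ρ₃ * g.dist y y'' ≤ ρ₃ * g.dist y z + ρ * g.dist z y'' := by
      have a1 := mul_le_mul_of_nonneg_left t1 hρ₃
      have a2 : ρ₃ * g.dist z y'' ≤ ρ * g.dist z y'' := mul_le_mul_of_nonneg_right h1 (hd _ _)
      nlinarith
    have e2 : ρ₃' * g.dist y y' ≤ ρ₃' * g.dist y z + ρ' * g.dist z y' := by
      have a1 := mul_le_mul_of_nonneg_left t2 hρ₃'
      have a2 : ρ₃' * g.dist z y' ≤ ρ' * g.dist z y' := mul_le_mul_of_nonneg_right h2 (hd _ _)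
      nlinarith
    have e3 : (ρ₃ + ρ₃' + σ) * g.dist y z ≤ ρS * g.dist y z := mul_le_mul_of_nonneg_right h3 (hd _ _)
    nlinarith
  calc ∑ z : g.Site, Real.exp (-(ρS * g.dist y z)) *
          (Real.exp (-(ρ * g.dist z y'')) * Real.exp (-(ρ' * g.dist z y')))
      ≤ ∑ z : g.Site, Real.exp (-(σ * g.dist y z)) *
          (Real.exp (-(ρ₃ * g.dist y y'')) * Real.exp (-(ρ₃' * g.dist y y'))) :=
        Finset.sum_le_sum fun z _ => hterm z
    _ = (∑ z : g.Site, Real.exp (-(σ * g.dist y z))) *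
          (Real.exp (-(ρ₃ * g.dist y y'')) * Real.exp (-(ρ₃' * g.dist y y'))) := by rw [Finset.sum_mul]
    _ ≤ c * (Real.exp (-(ρ₃ * g.dist y y'')) * Real.exp (-(ρ₃' * g.dist y y'))) :=
        mul_le_mul_of_nonneg_right (hrow y) (mul_nonneg (Real.exp_nonneg _) (Real.exp_nonneg _))

/-! ## Majorants of 𝔄-dependent operator families -/

/-- `HasMaj₂ bA b₁ b₂ T K`: the bilinear family T (𝔄 ↦ the operator T𝔄 : μ ↦ T𝔄μ) has MAJORANT K(y, y″, y′): for 𝔄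
localised near y′ and μ localised near y″, the size of T𝔄μ near y is ≤ K(y,y″,y′)·(size of μ at y″)·(size of 𝔄 at
y′).  This is the shape of every term of the second derivative (δ²V/δA′²)[𝔄] read as "an operator depending linearly
on the direction 𝔄", cf. (189): *"for supp 𝔄 ⊂ Δ̃(y′) … y ∈ Λ_j"*. [folklore] [cite: Balaban1985Variational, (189) p.308] -/
def HasMaj₂ (bA : BlockNorm g FA) (b₁ : BlockNorm g F₁) (b₂ : BlockNorm g F₂) (T : FA →ₗ[ℝ] F₁ →ₗ[ℝ] F₂)
    (K : g.Site → g.Site → g.Site → ℝ) : Prop :=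
  ∀ (y' : g.Site) (v : FA), bA.IsLoc y' v → ∀ (y'' : g.Site) (μ : F₁), b₁.IsLoc y'' μ →
    ∀ y : g.Site, b₂.loc y (T v μ) ≤ K y y'' y' * b₁.loc y'' μ * bA.loc y' v

/-- Monotonicity in the kernel. [folklore] -/
theorem HasMaj₂.mono {bA : BlockNorm g FA} {b₁ : BlockNorm g F₁} {b₂ : BlockNorm g F₂} {T : FA →ₗ[ℝ] F₁ →ₗ[ℝ] F₂}
    {K K' : g.Site → g.Site → g.Site → ℝ} (h : HasMaj₂ bA b₁ b₂ T K) (hle : ∀ y y'' y', K y y'' y' ≤ K' y y'' y') :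
    HasMaj₂ bA b₁ b₂ T K' :=
  fun y' v hv y'' μ hμ y => (h y' v hv y'' μ hμ y).trans
    (mul_le_mul_of_nonneg_right (mul_le_mul_of_nonneg_right (hle _ _ _) (b₁.loc_nonneg _ _)) (bA.loc_nonneg _ _))

/-- Majorants pass along pointwise-equal families. [folklore] -/
theorem HasMaj₂.congr {bA : BlockNorm g FA} {b₁ : BlockNorm g F₁} {b₂ : BlockNorm g F₂}
    {T T' : FA →ₗ[ℝ] F₁ →ₗ[ℝ] F₂} {K : g.Site → g.Site → g.Site → ℝ} (h : HasMaj₂ bA b₁ b₂ T K)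
    (hTT' : ∀ v μ, T v μ = T' v μ) : HasMaj₂ bA b₁ b₂ T' K :=
  fun y' v hv y'' μ hμ y => by rw [← hTT' v μ]; exact h y' v hv y'' μ hμ y

/-- The zero family. [folklore] -/
theorem hasMaj₂_zero (bA : BlockNorm g FA) (b₁ : BlockNorm g F₁) (b₂ : BlockNorm g F₂) :
    HasMaj₂ bA b₁ b₂ (0 : FA →ₗ[ℝ] F₁ →ₗ[ℝ] F₂) (fun _ _ _ => 0) := by
  intro y' v _ y'' μ _ y
  simp [b₂.loc_zero]

/-- Sums of families. [folklore] -/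
theorem HasMaj₂.add {bA : BlockNorm g FA} {b₁ : BlockNorm g F₁} {b₂ : BlockNorm g F₂}
    {T₁ T₂ : FA →ₗ[ℝ] F₁ →ₗ[ℝ] F₂} {K₁ K₂ : g.Site → g.Site → g.Site → ℝ}
    (h₁ : HasMaj₂ bA b₁ b₂ T₁ K₁) (h₂ : HasMaj₂ bA b₁ b₂ T₂ K₂) :
    HasMaj₂ bA b₁ b₂ (T₁ + T₂) (fun y y'' y' => K₁ y y'' y' + K₂ y y'' y') := by
  intro y' v hv y'' μ hμ y
  rw [LinearMap.add_apply, LinearMap.add_apply, add_mul, add_mul]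
  exact (b₂.loc_add_le y _ _).trans (add_le_add (h₁ y' v hv y'' μ hμ y) (h₂ y' v hv y'' μ hμ y))

/-- Sign. [folklore] -/
theorem HasMaj₂.neg {bA : BlockNorm g FA} {b₁ : BlockNorm g F₁} {b₂ : BlockNorm g F₂}
    {T : FA →ₗ[ℝ] F₁ →ₗ[ℝ] F₂} {K : g.Site → g.Site → g.Site → ℝ} (h : HasMaj₂ bA b₁ b₂ T K) :
    HasMaj₂ bA b₁ b₂ (-T) K := by
  intro y' v hv y'' μ hμ y
  rw [LinearMap.neg_apply, LinearMap.neg_apply, b₂.loc_neg]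
  exact h y' v hv y'' μ hμ y

/-- Differences. [folklore] -/
theorem HasMaj₂.sub {bA : BlockNorm g FA} {b₁ : BlockNorm g F₁} {b₂ : BlockNorm g F₂}
    {T₁ T₂ : FA →ₗ[ℝ] F₁ →ₗ[ℝ] F₂} {K₁ K₂ : g.Site → g.Site → g.Site → ℝ}
    (h₁ : HasMaj₂ bA b₁ b₂ T₁ K₁) (h₂ : HasMaj₂ bA b₁ b₂ T₂ K₂) :
    HasMaj₂ bA b₁ b₂ (T₁ - T₂) (fun y y'' y' => K₁ y y'' y' + K₂ y y'' y') := by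
  rw [sub_eq_add_neg]
  exact h₁.add h₂.neg

/-- CONTRACTION AGAINST A BOUNDED ARGUMENT: if T has majorant K ≥ 0 and X is a FIXED configuration of local size ≤ M
everywhere (e.g. (L^jη)⁻¹(QGQ*)⁻¹QA′ in the third term of (88), bounded by (77) and [5] (3.132); or A″ = A′ − HD(A′) in
(89)–(96), bounded by (53)–(55)), then 𝔄 ↦ T𝔄X is an operator with the ordinary majorant Σ_{y″}K(y,y″,y′)·κ·M —
through the partition of unity of the μ-space ([3] (2.52)). [folklore] [cite: Balaban1984PropagatorsII, (2.52) p.232] -/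
theorem HasMaj₂.apply_bounded {bA : BlockNorm g FA} {b₁ : BlockNorm g F₁} {b₂ : BlockNorm g F₂}
    {T : FA →ₗ[ℝ] F₁ →ₗ[ℝ] F₂} {K : g.Site → g.Site → g.Site → ℝ} {X : F₁} {M : ℝ} {W : FA →ₗ[ℝ] F₂}
    (h : HasMaj₂ bA b₁ b₂ T K) (hK : ∀ y y'' y', 0 ≤ K y y'' y') (hX : ∀ y'', b₁.loc y'' X ≤ M)
    (hW : ∀ v, W v = T v X) :
    HasMaj bA b₂ W (fun y y' => ∑ y'' : g.Site, K y y'' y' * (b₁.κ * M)) := by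
  intro y' v hv y
  have hdec : T v X = ∑ y'' : g.Site, T v (b₁.cut y'' X) := by
    conv_lhs => rw [← b₁.sum_cut X]
    rw [map_sum]
  rw [hW, hdec, Finset.sum_mul]
  refine (b₂.loc_sum_le y _ _).trans (Finset.sum_le_sum fun y'' _ => ?_)
  calc b₂.loc y (T v (b₁.cut y'' X)) ≤ K y y'' y' * b₁.loc y'' (b₁.cut y'' X) * bA.loc y' v :=
        h y' v hv y'' _ (b₁.isLoc_cut y'' X) y
    _ ≤ K y y'' y' * (b₁.κ * M) * bA.loc y' v := by
        refine mul_le_mul_of_nonneg_right (mul_le_mul_of_nonneg_left ?_ (hK _ _ _)) (bA.loc_nonneg _ _)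
        exact (b₁.loc_cut_le y'' X).trans (mul_le_mul_of_nonneg_left (hX y'') b₁.κ_nonneg)

/-- The contraction in closed form for a jointly exponential majorant: θe^{−ρd(y,y″)}e^{−ρ′d(y,y′)} contracted against
‖X‖ ≤ M gives the ordinary majorant κθMc·e^{−ρ′d(y,y′)}, the μ-rate ρ ≥ σ being spent on the row sum of Lemma 2.1 [3].
[folklore] [cite: Balaban1984PropagatorsII, Lemma 2.1 p.234] -/
theorem HasMaj₂.apply_bounded_exp {bA : BlockNorm g FA} {b₁ : BlockNorm g F₁} {b₂ : BlockNorm g F₂}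
    {T : FA →ₗ[ℝ] F₁ →ₗ[ℝ] F₂} {X : F₁} {W : FA →ₗ[ℝ] F₂} {M θ ρ ρ' σ c : ℝ}
    (hd : ∀ a b : g.Site, 0 ≤ g.dist a b) (hrow : RowSum g σ c) (hθ : 0 ≤ θ) (hM : 0 ≤ M) (hσρ : σ ≤ ρ)
    (h : HasMaj₂ bA b₁ b₂ T
      (fun y y'' y' => θ * Real.exp (-(ρ * g.dist y y'')) * Real.exp (-(ρ' * g.dist y y'))))
    (hX : ∀ y'', b₁.loc y'' X ≤ M) (hW : ∀ v, W v = T v X) :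
    HasMaj bA b₂ W (fun y y' => b₁.κ * θ * M * c * Real.exp (-(ρ' * g.dist y y'))) := by
  refine (h.apply_bounded (fun y y'' y' => mul_nonneg (mul_nonneg hθ (Real.exp_nonneg _)) (Real.exp_nonneg _))
    hX hW).mono fun y y' => ?_
  have hrow' : RowSum g ρ c := hrow.mono hd hσρ
  have hnn : 0 ≤ b₁.κ * θ * M * Real.exp (-(ρ' * g.dist y y')) :=
    mul_nonneg (mul_nonneg (mul_nonneg b₁.κ_nonneg hθ) hM) (Real.exp_nonneg _)
  calc ∑ y'' : g.Site, θ * Real.exp (-(ρ * g.dist y y'')) * Real.exp (-(ρ' * g.dist y y')) * (b₁.κ * M)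
      = b₁.κ * θ * M * Real.exp (-(ρ' * g.dist y y')) * ∑ y'' : g.Site, Real.exp (-(ρ * g.dist y y'')) := by
        rw [Finset.mul_sum]
        exact Finset.sum_congr rfl fun y'' _ => by ring
    _ ≤ b₁.κ * θ * M * Real.exp (-(ρ' * g.dist y y')) * c := mul_le_mul_of_nonneg_left (hrow' y) hnn
    _ = b₁.κ * θ * M * c * Real.exp (-(ρ' * g.dist y y')) := by ring

/-- POST-COMPOSITION with a fixed operator S (e.g. (I + ℜ)⁻¹ of (71), H of (46), Q*(QGQ*)⁻¹ of (88)): majorants compose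
by 𝔅-convolution in the output variable, cost κ of the intermediate space. [folklore] [cite: Balaban1984PropagatorsII,
(2.51)–(2.53) p.232] -/
theorem HasMaj₂.postcomp {bA : BlockNorm g FA} {b₁ : BlockNorm g F₁} {b₂ : BlockNorm g F₂} {b₃ : BlockNorm g F₃}
    {T : FA →ₗ[ℝ] F₁ →ₗ[ℝ] F₂} {S : F₂ →ₗ[ℝ] F₃} {T' : FA →ₗ[ℝ] F₁ →ₗ[ℝ] F₃}
    {K : g.Site → g.Site → g.Site → ℝ} {KS : g.Site → g.Site → ℝ}
    (h : HasMaj₂ bA b₁ b₂ T K) (hS : HasMaj b₂ b₃ S KS) (hKS : ∀ a b, 0 ≤ KS a b)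
    (hT' : ∀ v μ, T' v μ = S (T v μ)) :
    HasMaj₂ bA b₁ b₃ T' (fun y y'' y' => ∑ z : g.Site, KS y z * (b₂.κ * K z y'' y')) := by
  intro y' v hv y'' μ hμ y
  have hdec : S (T v μ) = ∑ z : g.Site, S (b₂.cut z (T v μ)) := by
    conv_lhs => rw [← b₂.sum_cut (T v μ)]
    rw [map_sum]
  rw [hT', hdec, Finset.sum_mul, Finset.sum_mul]
  refine (b₃.loc_sum_le y _ _).trans (Finset.sum_le_sum fun z _ => ?_)
  calc b₃.loc y (S (b₂.cut z (T v μ))) ≤ KS y z * b₂.loc z (b₂.cut z (T v μ)) := hS z _ (b₂.isLoc_cut z _) y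
    _ ≤ KS y z * (b₂.κ * b₂.loc z (T v μ)) := mul_le_mul_of_nonneg_left (b₂.loc_cut_le z _) (hKS _ _)
    _ ≤ KS y z * (b₂.κ * (K z y'' y' * b₁.loc y'' μ * bA.loc y' v)) :=
        mul_le_mul_of_nonneg_left (mul_le_mul_of_nonneg_left (h y' v hv y'' μ hμ z) b₂.κ_nonneg) (hKS _ _)
    _ = KS y z * (b₂.κ * K z y'' y') * b₁.loc y'' μ * bA.loc y' v := by ring

/-- Post-composition in closed form: S of majorant a_S e^{−ρ_S d} after a family of majorant θe^{−ρd(·,y″)}e^{−ρ′d(·,y′)}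
gives κ a_S θ c·e^{−ρ₃d(y,y″)}e^{−ρ₃′d(y,y′)} for any ρ₃ ≤ ρ, ρ₃′ ≤ ρ′ with ρ₃ + ρ₃′ + σ ≤ ρ_S (`conv_exp_le₃`).  With
ρ_S = ½δ₀ ((71)) this is the cap ρ₃ + ρ₃′ ≤ ½δ₀ − σ on the joint rate of δ𝔇 = (δ²/δA′²)D.
[folklore] [cite: Balaban1984PropagatorsII, (2.54) p.233 + Lemma 2.1 p.234] -/
theorem HasMaj₂.postcomp_exp {bA : BlockNorm g FA} {b₁ : BlockNorm g F₁} {b₂ : BlockNorm g F₂}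
    {b₃ : BlockNorm g F₃} {T : FA →ₗ[ℝ] F₁ →ₗ[ℝ] F₂} {S : F₂ →ₗ[ℝ] F₃} {T' : FA →ₗ[ℝ] F₁ →ₗ[ℝ] F₃}
    {aS ρS θ ρ ρ' ρ₃ ρ₃' σ c : ℝ}
    (htri : Triangle254 g) (hd : ∀ a b : g.Site, 0 ≤ g.dist a b) (hrow : RowSum g σ c) (haS : 0 ≤ aS)
    (hθ : 0 ≤ θ) (hρ₃ : 0 ≤ ρ₃) (hρ₃' : 0 ≤ ρ₃') (h1 : ρ₃ ≤ ρ) (h2 : ρ₃' ≤ ρ') (h3 : ρ₃ + ρ₃' + σ ≤ ρS)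
    (h : HasMaj₂ bA b₁ b₂ T
      (fun y y'' y' => θ * Real.exp (-(ρ * g.dist y y'')) * Real.exp (-(ρ' * g.dist y y'))))
    (hS : HasMaj b₂ b₃ S (fun a b => aS * Real.exp (-(ρS * g.dist a b))))
    (hT' : ∀ v μ, T' v μ = S (T v μ)) :
    HasMaj₂ bA b₁ b₃ T' (fun y y'' y' =>
      b₂.κ * aS * θ * c * Real.exp (-(ρ₃ * g.dist y y'')) * Real.exp (-(ρ₃' * g.dist y y'))) := by
  refine (h.postcomp hS (fun a b => mul_nonneg haS (Real.exp_nonneg _)) hT').mono fun y y'' y' => ?_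
  have hconv := conv_exp_le₃ htri hd hrow hρ₃ hρ₃' h1 h2 h3 y y'' y'
  calc ∑ z : g.Site, aS * Real.exp (-(ρS * g.dist y z)) *
          (b₂.κ * (θ * Real.exp (-(ρ * g.dist z y'')) * Real.exp (-(ρ' * g.dist z y'))))
      = b₂.κ * aS * θ * ∑ z : g.Site, Real.exp (-(ρS * g.dist y z)) *
          (Real.exp (-(ρ * g.dist z y'')) * Real.exp (-(ρ' * g.dist z y'))) := by
        rw [Finset.mul_sum]
        exact Finset.sum_congr rfl fun z _ => by ring
    _ ≤ b₂.κ * aS * θ * (c * (Real.exp (-(ρ₃ * g.dist y y'')) * Real.exp (-(ρ₃' * g.dist y y')))) :=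
        mul_le_mul_of_nonneg_left hconv (mul_nonneg (mul_nonneg b₂.κ_nonneg haS) hθ)
    _ = b₂.κ * aS * θ * c * Real.exp (-(ρ₃ * g.dist y y'')) * Real.exp (-(ρ₃' * g.dist y y')) := by ring

/-- PRE-COMPOSITION IN THE ARGUMENT SLOT with a fixed operator U (e.g. H𝔇 in the differentiated (68), or H in ℜ):
T𝔄(Uν) has majorant Σ_z K(y,z,y′)·κ·K_U(z,y″). [folklore] [cite: Balaban1984PropagatorsII, (2.51)–(2.53) p.232] -/
theorem HasMaj₂.precomp₂ {bA : BlockNorm g FA} {b₀ : BlockNorm g F₀} {b₁ : BlockNorm g F₁} {b₂ : BlockNorm g F₂}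
    {T : FA →ₗ[ℝ] F₁ →ₗ[ℝ] F₂} {U : F₀ →ₗ[ℝ] F₁} {T' : FA →ₗ[ℝ] F₀ →ₗ[ℝ] F₂}
    {K : g.Site → g.Site → g.Site → ℝ} {KU : g.Site → g.Site → ℝ}
    (h : HasMaj₂ bA b₁ b₂ T K) (hU : HasMaj b₀ b₁ U KU) (hK : ∀ y y'' y', 0 ≤ K y y'' y')
    (hT' : ∀ v ν, T' v ν = T v (U ν)) :
    HasMaj₂ bA b₀ b₂ T' (fun y y'' y' => ∑ z : g.Site, K y z y' * (b₁.κ * KU z y'')) := by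
  intro y' v hv y'' ν hν y
  have hdec : T v (U ν) = ∑ z : g.Site, T v (b₁.cut z (U ν)) := by
    conv_lhs => rw [← b₁.sum_cut (U ν)]
    rw [map_sum]
  rw [hT', hdec, Finset.sum_mul, Finset.sum_mul]
  refine (b₂.loc_sum_le y _ _).trans (Finset.sum_le_sum fun z _ => ?_)
  calc b₂.loc y (T v (b₁.cut z (U ν))) ≤ K y z y' * b₁.loc z (b₁.cut z (U ν)) * bA.loc y' v :=
        h y' v hv z _ (b₁.isLoc_cut z _) y
    _ ≤ K y z y' * (b₁.κ * (KU z y'' * b₀.loc y'' ν)) * bA.loc y' v := by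
        refine mul_le_mul_of_nonneg_right (mul_le_mul_of_nonneg_left ?_ (hK _ _ _)) (bA.loc_nonneg _ _)
        exact (b₁.loc_cut_le z _).trans (mul_le_mul_of_nonneg_left (hU y'' ν hν z) b₁.κ_nonneg)
    _ = K y z y' * (b₁.κ * KU z y'') * b₀.loc y'' ν * bA.loc y' v := by ring

/-- Pre-composition in the argument slot, closed form: the μ-rate becomes any ρ₂ ≤ ρ_U with ρ₂ + σ ≤ ρ (the margin is
taken from the family's own μ-rate ρ — for a local leaf this is the identity-locality rate, as large as one likes).
[folklore] [cite: Balaban1984PropagatorsII, (2.54) p.233 + Lemma 2.1 p.234] -/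
theorem HasMaj₂.precomp₂_exp {bA : BlockNorm g FA} {b₀ : BlockNorm g F₀} {b₁ : BlockNorm g F₁}
    {b₂ : BlockNorm g F₂} {T : FA →ₗ[ℝ] F₁ →ₗ[ℝ] F₂} {U : F₀ →ₗ[ℝ] F₁} {T' : FA →ₗ[ℝ] F₀ →ₗ[ℝ] F₂}
    {θ ρ ρ' aU ρU ρ₂ σ c : ℝ}
    (htri : Triangle254 g) (hd : ∀ a b : g.Site, 0 ≤ g.dist a b) (hrow : RowSum g σ c) (hθ : 0 ≤ θ)
    (haU : 0 ≤ aU) (hρ₂ : 0 ≤ ρ₂) (h1 : ρ₂ ≤ ρU) (h2 : ρ₂ + σ ≤ ρ)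
    (h : HasMaj₂ bA b₁ b₂ T
      (fun y y'' y' => θ * Real.exp (-(ρ * g.dist y y'')) * Real.exp (-(ρ' * g.dist y y'))))
    (hU : HasMaj b₀ b₁ U (fun a b => aU * Real.exp (-(ρU * g.dist a b))))
    (hT' : ∀ v ν, T' v ν = T v (U ν)) :
    HasMaj₂ bA b₀ b₂ T' (fun y y'' y' =>
      b₁.κ * θ * aU * c * Real.exp (-(ρ₂ * g.dist y y'')) * Real.exp (-(ρ' * g.dist y y'))) := by
  refine (h.precomp₂ hU (fun y y'' y' => mul_nonneg (mul_nonneg hθ (Real.exp_nonneg _)) (Real.exp_nonneg _))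
    hT').mono fun y y'' y' => ?_
  have hconv := conv_exp_le htri hd hrow hρ₂ h1 h2 y y''
  have hnn : 0 ≤ b₁.κ * θ * aU * Real.exp (-(ρ' * g.dist y y')) :=
    mul_nonneg (mul_nonneg (mul_nonneg b₁.κ_nonneg hθ) haU) (Real.exp_nonneg _)
  calc ∑ z : g.Site, θ * Real.exp (-(ρ * g.dist y z)) * Real.exp (-(ρ' * g.dist y y')) *
          (b₁.κ * (aU * Real.exp (-(ρU * g.dist z y''))))
      = b₁.κ * θ * aU * Real.exp (-(ρ' * g.dist y y')) *
          ∑ z : g.Site, Real.exp (-(ρ * g.dist y z)) * Real.exp (-(ρU * g.dist z y'')) := by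
        rw [Finset.mul_sum]
        exact Finset.sum_congr rfl fun z _ => by ring
    _ ≤ b₁.κ * θ * aU * Real.exp (-(ρ' * g.dist y y')) * (c * Real.exp (-(ρ₂ * g.dist y y''))) :=
        mul_le_mul_of_nonneg_left hconv hnn
    _ = b₁.κ * θ * aU * c * Real.exp (-(ρ₂ * g.dist y y'')) * Real.exp (-(ρ' * g.dist y y')) := by ring

/-- PRE-COMPOSITION IN THE DIRECTION SLOT with a fixed operator U′ (in (189): U′ = I − H𝔇, the derivative of
A = A′ − HD(A′), of majorant (1 + O(1)C₃ε₃c)e^{−½δ₀d} by (46), (73)): T(U′𝔄′)μ has majorant Σ_z K(y,y″,z)·κ·K_{U′}(z,y′).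
[folklore] [cite: Balaban1984PropagatorsII, (2.51)–(2.53) p.232] -/
theorem HasMaj₂.precomp₁ {bA : BlockNorm g FA} {bA' : BlockNorm g FA'} {b₁ : BlockNorm g F₁} {b₂ : BlockNorm g F₂}
    {T : FA →ₗ[ℝ] F₁ →ₗ[ℝ] F₂} {U' : FA' →ₗ[ℝ] FA} {T' : FA' →ₗ[ℝ] F₁ →ₗ[ℝ] F₂}
    {K : g.Site → g.Site → g.Site → ℝ} {KU' : g.Site → g.Site → ℝ}
    (h : HasMaj₂ bA b₁ b₂ T K) (hU' : HasMaj bA' bA U' KU') (hK : ∀ y y'' y', 0 ≤ K y y'' y')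
    (hT' : ∀ v' μ, T' v' μ = T (U' v') μ) :
    HasMaj₂ bA' b₁ b₂ T' (fun y y'' y' => ∑ z : g.Site, K y y'' z * (bA.κ * KU' z y')) := by
  intro y' v' hv' y'' μ hμ y
  have hdec : T (U' v') μ = ∑ z : g.Site, T (bA.cut z (U' v')) μ := by
    conv_lhs => rw [← bA.sum_cut (U' v')]
    rw [map_sum, LinearMap.sum_apply]
  rw [hT', hdec, Finset.sum_mul, Finset.sum_mul]
  refine (b₂.loc_sum_le y _ _).trans (Finset.sum_le_sum fun z _ => ?_)
  calc b₂.loc y (T (bA.cut z (U' v')) μ) ≤ K y y'' z * b₁.loc y'' μ * bA.loc z (bA.cut z (U' v')) :=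
        h z _ (bA.isLoc_cut z _) y'' μ hμ y
    _ ≤ K y y'' z * b₁.loc y'' μ * (bA.κ * (KU' z y' * bA'.loc y' v')) := by
        refine mul_le_mul_of_nonneg_left ?_ (mul_nonneg (hK _ _ _) (b₁.loc_nonneg _ _))
        exact (bA.loc_cut_le z _).trans (mul_le_mul_of_nonneg_left (hU' y' v' hv' z) bA.κ_nonneg)
    _ = K y y'' z * (bA.κ * KU' z y') * b₁.loc y'' μ * bA'.loc y' v' := by ring

/-- Pre-composition in the direction slot, closed form: the 𝔄-rate becomes any ρ₂′ ≤ ρ_{U′} with ρ₂′ + σ ≤ ρ′.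
[folklore] [cite: Balaban1984PropagatorsII, (2.54) p.233 + Lemma 2.1 p.234] -/
theorem HasMaj₂.precomp₁_exp {bA : BlockNorm g FA} {bA' : BlockNorm g FA'} {b₁ : BlockNorm g F₁}
    {b₂ : BlockNorm g F₂} {T : FA →ₗ[ℝ] F₁ →ₗ[ℝ] F₂} {U' : FA' →ₗ[ℝ] FA} {T' : FA' →ₗ[ℝ] F₁ →ₗ[ℝ] F₂}
    {θ ρ ρ' aU' ρU' ρ₂' σ c : ℝ}
    (htri : Triangle254 g) (hd : ∀ a b : g.Site, 0 ≤ g.dist a b) (hrow : RowSum g σ c) (hθ : 0 ≤ θ)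
    (haU' : 0 ≤ aU') (hρ₂' : 0 ≤ ρ₂') (h1 : ρ₂' ≤ ρU') (h2 : ρ₂' + σ ≤ ρ')
    (h : HasMaj₂ bA b₁ b₂ T
      (fun y y'' y' => θ * Real.exp (-(ρ * g.dist y y'')) * Real.exp (-(ρ' * g.dist y y'))))
    (hU' : HasMaj bA' bA U' (fun a b => aU' * Real.exp (-(ρU' * g.dist a b))))
    (hT' : ∀ v' μ, T' v' μ = T (U' v') μ) :
    HasMaj₂ bA' b₁ b₂ T' (fun y y'' y' =>
      bA.κ * θ * aU' * c * Real.exp (-(ρ * g.dist y y'')) * Real.exp (-(ρ₂' * g.dist y y'))) := by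
  refine (h.precomp₁ hU' (fun y y'' y' => mul_nonneg (mul_nonneg hθ (Real.exp_nonneg _)) (Real.exp_nonneg _))
    hT').mono fun y y'' y' => ?_
  have hconv := conv_exp_le htri hd hrow hρ₂' h1 h2 y y'
  have hnn : 0 ≤ bA.κ * θ * aU' * Real.exp (-(ρ * g.dist y y'')) :=
    mul_nonneg (mul_nonneg (mul_nonneg bA.κ_nonneg hθ) haU') (Real.exp_nonneg _)
  calc ∑ z : g.Site, θ * Real.exp (-(ρ * g.dist y y'')) * Real.exp (-(ρ' * g.dist y z)) *
          (bA.κ * (aU' * Real.exp (-(ρU' * g.dist z y'))))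
      = bA.κ * θ * aU' * Real.exp (-(ρ * g.dist y y'')) *
          ∑ z : g.Site, Real.exp (-(ρ' * g.dist y z)) * Real.exp (-(ρU' * g.dist z y')) := by
        rw [Finset.mul_sum]
        exact Finset.sum_congr rfl fun z _ => by ring
    _ ≤ bA.κ * θ * aU' * Real.exp (-(ρ * g.dist y y'')) * (c * Real.exp (-(ρ₂' * g.dist y y'))) :=
        mul_le_mul_of_nonneg_left hconv hnn
    _ = bA.κ * θ * aU' * c * Real.exp (-(ρ * g.dist y y'')) * Real.exp (-(ρ₂' * g.dist y y')) := by ring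

/-- THE LOCAL BILINEAR LEAF.  A family with loc_y(T𝔄μ) ≤ β·loc_y μ·loc_y 𝔄 for every y — the second derivative of a
LOCAL analytic functional: of L^jηC_j(U₀, A) restricted to c ([4] Prop. 4, p. 38: Q_k(U₀, ηA, c) *"is an analytic
function of the variables A_b, b ⊂ B^k(c₋)∪B^k(c₊)"*, *"|C_k(U₀, A)| ≤ C₂|A|² < C₂α₁². (135)"*), by the Cauchy formula in
two variables on the polydisc given by the hypothesis α₁ ≤ c₄ of that proposition (a hypothesis, not a quoted phrase);
of V₀′(A, ∂p) ((39)–(40); p. 291: the first derivative *"satisfies a bound similar to the bound (40) … but with the power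
of |A| lower by 1, and with a different absolute constant"* — for the second derivative, lower by 2); of the commutator
polynomials (91)–(96) — has, given the identity-localities of the two input sizes (for sharp blocks: a = a′ = 1 at any
rate), the majorant β·a·a′·e^{−ρd(y,y″)}e^{−ρ′d(y,y′)}. [folklore] [cite: Balaban1985Averaging, Prop. 4 (134)–(135);
Balaban1985Variational, (39)–(40) p.284 + p.291 + (91)–(96) p.292] -/
theorem hasMaj₂_local {bA : BlockNorm g FA} {b₁ : BlockNorm g F₁} {b₂ : BlockNorm g F₂}
    {T : FA →ₗ[ℝ] F₁ →ₗ[ℝ] F₂} {β aI ρI aA ρA : ℝ} (hβ : 0 ≤ β) (haI : 0 ≤ aI)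
    (hloc : ∀ y v μ, b₂.loc y (T v μ) ≤ β * b₁.loc y μ * bA.loc y v)
    (hI₁ : HasMaj b₁ b₁ LinearMap.id (fun y y'' => aI * Real.exp (-(ρI * g.dist y y''))))
    (hIA : HasMaj bA bA LinearMap.id (fun y y' => aA * Real.exp (-(ρA * g.dist y y')))) :
    HasMaj₂ bA b₁ b₂ T
      (fun y y'' y' => β * aI * aA * Real.exp (-(ρI * g.dist y y'')) * Real.exp (-(ρA * g.dist y y'))) := by
  intro y' v hv y'' μ hμ y
  have h1 : b₁.loc y μ ≤ aI * Real.exp (-(ρI * g.dist y y'')) * b₁.loc y'' μ := by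
    have := hI₁ y'' μ hμ y
    rwa [LinearMap.id_apply] at this
  have h2 : bA.loc y v ≤ aA * Real.exp (-(ρA * g.dist y y')) * bA.loc y' v := by
    have := hIA y' v hv y
    rwa [LinearMap.id_apply] at this
  calc b₂.loc y (T v μ) ≤ β * b₁.loc y μ * bA.loc y v := hloc y v μ
    _ ≤ β * (aI * Real.exp (-(ρI * g.dist y y'')) * b₁.loc y'' μ) *
          (aA * Real.exp (-(ρA * g.dist y y')) * bA.loc y' v) :=
        mul_le_mul (mul_le_mul_of_nonneg_left h1 hβ) h2 (bA.loc_nonneg _ _)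
          (mul_nonneg hβ (mul_nonneg (mul_nonneg haI (Real.exp_nonneg _)) (b₁.loc_nonneg _ _)))
    _ = β * aI * aA * Real.exp (-(ρI * g.dist y y'')) * Real.exp (-(ρA * g.dist y y')) *
          b₁.loc y'' μ * bA.loc y' v := by ring

/-! ## The located unprinted intermediate: δ𝔇 = (δ²/δA′²)D(A′) -/

/-- The constant of one term of δ𝔇 (`d2D_shape`): θ = κ₂a_S·[κ_A a_{U′}·(κ₁βa_Ia_A·a_R·c)·c]·c — the O(1)C₂ of the
supplied bound (U1′) (cell note SECOND-DERIVATIVE-189.md §4). [cite: Balaban1985Variational, (189) p.308] -/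
noncomputable def thetaShape (κ₁ κA κ₂ β aI aA aR aU' aS c : ℝ) : ℝ :=
  κ₂ * aS * (κA * (κ₁ * (β * aI * aA) * aR * c) * aU' * c) * c

/-- θ ≥ 0 for non-negative data. [folklore] -/
theorem thetaShape_nonneg {κ₁ κA κ₂ β aI aA aR aU' aS c : ℝ} (hκ₁ : 0 ≤ κ₁) (hκA : 0 ≤ κA) (hκ₂ : 0 ≤ κ₂)
    (hβ : 0 ≤ β) (haI : 0 ≤ aI) (haA : 0 ≤ aA) (haR : 0 ≤ aR) (haU' : 0 ≤ aU') (haS : 0 ≤ aS) (hc : 0 ≤ c) :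
    0 ≤ thetaShape κ₁ κA κ₂ β aI aA aR aU' aS c := by
  unfold thetaShape
  positivity

/-- **ONE TERM OF δ𝔇 = (δ²/δA′²)D** — the located, unprinted intermediate of (189) in its exact shape, KERNEL-CHECKED.
Differentiating (68) in the direction 𝔄′ (with A = A′ − HD(A′), δA[𝔄′] = (I − H𝔇)𝔄′ =: U′𝔄′) gives
[I + ℜ(A′)]·δ𝔇[𝔄′] = (two terms of the form) Φ(U′𝔄′)(R ·), Φ = the second A-derivative of L^jηC_j at the
configuration L^jη(A′ − HD(A′)) — LOCAL ([4] Prop. 4) — and R ∈ {the restriction to the blocks at c, H𝔇}; hence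
δ𝔇[𝔄′]ν = S(Φ(U′𝔄′)(Rν)) with S = (I + ℜ)⁻¹.  HYPOTHESES, each of a printed shape: `hS` = (71) (a_S = 2, rate ½δ₀);
`hR` = a majorant of R at rate ½δ₀ (identity, or H𝔇 by (46) + (73) + `B11SectG.hasMaj_comp_exp`); `hU'` = I − H𝔇 at
rate ½δ₀; `hloc` + `hI₁` + `hIA` = locality of Φ (β = O(1)C₂ by Cauchy on [4] (134)–(135)) and of the sizes (rate δ₀,
any rate for sharp blocks); Lemma 2.1 [3] summed at σ = ⅛δ₀; (2.54) [3]; d ≥ 0; δ₀ ≥ 0.  CONCLUSION: the joint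
majorant θ·e^{−⅛δ₀d(y,y″)}·e^{−¼δ₀d(y,y′)}, θ = `thetaShape …` — rates forced by ρ + ρ′ + σ ≤ ½δ₀ (`postcomp_exp`).
The paper prints neither the differentiated (68) nor this bound (p. 308: *"We do not perform these calculations
here"*); it is the residual of cell GAPS G-B11-G2(a), supplied. [cite: Balaban1985Variational, (68)–(73) pp.288–289 +
p.307 + (189) p.308; Balaban1985Averaging, Prop. 4 (134)–(135); Balaban1984PropagatorsII, Lemma 2.1 p.234] -/
theorem d2D_shape {bN : BlockNorm g FA'} {bA : BlockNorm g FA} {b₀ : BlockNorm g F₀} {b₁ : BlockNorm g F₁}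
    {b₂ : BlockNorm g F₂} {b₃ : BlockNorm g F₃}
    {Φ : FA →ₗ[ℝ] F₁ →ₗ[ℝ] F₂} {R : F₀ →ₗ[ℝ] F₁} {U' : FA' →ₗ[ℝ] FA} {S : F₂ →ₗ[ℝ] F₃}
    {T : FA' →ₗ[ℝ] F₀ →ₗ[ℝ] F₃} {δ₀ β aI aA aR aU' aS c : ℝ}
    (htri : Triangle254 g) (hd : ∀ a b : g.Site, 0 ≤ g.dist a b) (hδ₀ : 0 ≤ δ₀) (hrow : RowSum g (δ₀ / 8) c)
    (hβ : 0 ≤ β) (haI : 0 ≤ aI) (haA : 0 ≤ aA) (haR : 0 ≤ aR) (haU' : 0 ≤ aU') (haS : 0 ≤ aS) (hc : 0 ≤ c)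
    (hloc : ∀ y v μ, b₂.loc y (Φ v μ) ≤ β * b₁.loc y μ * bA.loc y v)
    (hI₁ : HasMaj b₁ b₁ LinearMap.id (fun y y'' => aI * Real.exp (-(δ₀ * g.dist y y''))))
    (hIA : HasMaj bA bA LinearMap.id (fun y y' => aA * Real.exp (-(δ₀ * g.dist y y'))))
    (hR : HasMaj b₀ b₁ R (fun a b => aR * Real.exp (-(δ₀ / 2 * g.dist a b))))
    (hU' : HasMaj bN bA U' (fun a b => aU' * Real.exp (-(δ₀ / 2 * g.dist a b))))
    (hS : HasMaj b₂ b₃ S (fun a b => aS * Real.exp (-(δ₀ / 2 * g.dist a b))))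
    (hT : ∀ v' ν, T v' ν = S (Φ (U' v') (R ν))) :
    HasMaj₂ bN b₀ b₃ T (fun y y'' y' => thetaShape b₁.κ bA.κ b₂.κ β aI aA aR aU' aS c *
      Real.exp (-(δ₀ / 8 * g.dist y y'')) * Real.exp (-(δ₀ / 4 * g.dist y y'))) := by
  -- the leaf: Φ has the joint majorant β aI aA e^{−δ₀d(y,y″)} e^{−δ₀d(y,y′)}
  have h0 := hasMaj₂_local (T := Φ) hβ haI hloc hI₁ hIA
  -- precompose the argument slot with R: μ-rate ½δ₀ (≤ rate of R; ½δ₀ + ⅛δ₀ ≤ δ₀)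
  have h1 := h0.precomp₂_exp (T' := Φ.compl₂ R) (ρ₂ := δ₀ / 2) htri hd hrow
    (mul_nonneg (mul_nonneg hβ haI) haA) haR (by linarith) le_rfl (by linarith) hR
    (fun v ν => by rw [LinearMap.compl₂_apply])
  -- precompose the direction slot with U′: 𝔄-rate ½δ₀
  have h2 := h1.precomp₁_exp (T' := (Φ.compl₂ R).comp U') (ρ₂' := δ₀ / 2) htri hd hrow
    (mul_nonneg (mul_nonneg (mul_nonneg b₁.κ_nonneg (mul_nonneg (mul_nonneg hβ haI) haA)) haR) hc) haU'
    (by linarith) le_rfl (by linarith) hU' (fun v' ν => by rw [LinearMap.comp_apply])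
  -- postcompose with S = (I + ℜ)⁻¹ at rate ½δ₀: joint rates ⅛δ₀ + ¼δ₀ + ⅛δ₀ = ½δ₀
  have h3 := h2.postcomp_exp (T' := T) (ρ₃ := δ₀ / 8) (ρ₃' := δ₀ / 4) htri hd hrow haS
    (mul_nonneg (mul_nonneg (mul_nonneg bA.κ_nonneg (mul_nonneg (mul_nonneg (mul_nonneg b₁.κ_nonneg
      (mul_nonneg (mul_nonneg hβ haI) haA)) haR) hc)) haU') hc)
    (by linarith) (by linarith) (by linarith) (by linarith) (by linarith) hS
    (fun v' ν => by rw [hT, LinearMap.comp_apply, LinearMap.compl₂_apply])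
  refine h3.mono fun y y'' y' => le_of_eq ?_
  unfold thetaShape
  ring

/-- **δ𝔇 = (δ²/δA′²)D(A′), both terms** (the differentiated (68) has two right-hand terms: from δS and from −δℜ·𝔇):
T = T₁ − T₂ with T₁, T₂ of the shape of `d2D_shape` ⇒ the joint majorant (θ₁ + θ₂)e^{−⅛δ₀d(y,y″)}e^{−¼δ₀d(y,y′)}.
The same lemma serves the TRANSPOSED family (δ𝔇[𝔄])* of (85) and of the third term of (88) (S = the transpose of R or
of U′, R = ((I + ℜ)⁻¹)*: kernel bounds are orientation-free, [3] (2.51)). [cite: Balaban1985Variational, (68)–(73)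
pp.288–289 + (85), (88) pp.291–292 + (189) p.308] -/
theorem d2D_hasMaj₂ {bN : BlockNorm g FA'} {b₀ : BlockNorm g F₀} {b₃ : BlockNorm g F₃}
    {T T₁ T₂ : FA' →ₗ[ℝ] F₀ →ₗ[ℝ] F₃} {δ₀ θ₁ θ₂ : ℝ}
    (h₁ : HasMaj₂ bN b₀ b₃ T₁
      (fun y y'' y' => θ₁ * Real.exp (-(δ₀ / 8 * g.dist y y'')) * Real.exp (-(δ₀ / 4 * g.dist y y'))))
    (h₂ : HasMaj₂ bN b₀ b₃ T₂
      (fun y y'' y' => θ₂ * Real.exp (-(δ₀ / 8 * g.dist y y'')) * Real.exp (-(δ₀ / 4 * g.dist y y'))))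
    (hT : ∀ v' ν, T v' ν = T₁ v' ν - T₂ v' ν) :
    HasMaj₂ bN b₀ b₃ T
      (fun y y'' y' => (θ₁ + θ₂) * Real.exp (-(δ₀ / 8 * g.dist y y'')) * Real.exp (-(δ₀ / 4 * g.dist y y'))) := by
  refine ((h₁.sub h₂).congr fun v' ν => ?_).mono fun y y'' y' => le_of_eq (by ring)
  rw [LinearMap.sub_apply, LinearMap.sub_apply, hT]

/-! ## The assembly of (189) -/

/-- **(189) FROM ITS TERM CENSUS**, KERNEL-CHECKED: if (δ²/δA′²)V(A′) = Σ_{i<n} W_i (the finitely many terms obtained by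
differentiating (85), (88)–(96) a second time — the census of `SECOND-DERIVATIVE-189.md` §5) and each W_i has a
majorant θ_i e^{−ρ_i d(y,y′)} with ρ_i ≥ ¼δ₀ from the N-size max{|·|_{(−1)}, |∇·|_{(−2)}} (`bN`) to the output size
(`b3`, carrying (L^jη)³), then `Ineq189 bN b3 W (Σθ_i) δ₀`.  The content of (189) beyond this bookkeeping is the list
of θ_i ≤ O(1)ε₃(L^jη)^{−3} and ρ_i ∈ {¼δ₀, ½δ₀, δ₀} — per term a product of printed constants and
`d2D_shape`/`apply_bounded_exp`/`B11SectG.hasMaj_comp_exp`. [cite: Balaban1985Variational, (85), (88)–(96) pp.291–292 +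
(189) p.308] -/
theorem ineq189_of_terms {F3 : Type} [AddCommGroup F3] [Module ℝ F3] {bN : BlockNorm g FA} {b3 : BlockNorm g F3}
    {W : FA →ₗ[ℝ] F3} (Wt : ℕ → FA →ₗ[ℝ] F3) (θ ρ : ℕ → ℝ) (n : ℕ) {δ₀ : ℝ}
    (hd : ∀ a b : g.Site, 0 ≤ g.dist a b) (hθ : ∀ i, 0 ≤ θ i) (hρ : ∀ i, δ₀ / 4 ≤ ρ i)
    (hWt : ∀ i, HasMaj bN b3 (Wt i) (fun y y' => θ i * Real.exp (-(ρ i * g.dist y y'))))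
    (hW : ∀ v, W v = ∑ i ∈ Finset.range n, Wt i v) :
    Ineq189 bN b3 W (∑ i ∈ Finset.range n, θ i) δ₀ := by
  have h := hasMaj_sum Wt (fun i y y' => θ i * Real.exp (-(δ₀ / 4 * g.dist y y')))
    (fun i => (hWt i).of_rate_le hd (hθ i) (hρ i)) n
  unfold Ineq189
  refine (h.congr fun v => ?_).mono fun y y' => le_of_eq ?_
  · rw [LinearMap.sum_apply, hW]
  · simp only [Finset.sum_mul]

/-- **A δ𝔇-TYPE TERM OF (189)**: a family of joint majorant θe^{−⅛δ₀d(y,y″)}e^{−¼δ₀d(y,y′)} (`d2D_hasMaj₂`) applied to a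
fixed configuration of size ≤ M (e.g. the third term of (88): δ𝔇*[𝔄]·(L^jη)⁻¹(QGQ*)⁻¹QA′, M ≤ O(1)(L^jη)⁻³·4ε₃L^jη… by
(77) and [5] (3.132); or (85): (δ𝔇₂[𝔄])ᵀ·⟨HᵀJ⟩) is a term W_i of `ineq189_of_terms` with θ_i = κθMc and ρ_i = ¼δ₀
exactly — the printed rate of (189). [cite: Balaban1985Variational, (85), (88) pp.291–292 + (189) p.308] -/
theorem term189_of_d2D {bN : BlockNorm g FA'} {b₀ : BlockNorm g F₀} {b₃ : BlockNorm g F₃}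
    {T : FA' →ₗ[ℝ] F₀ →ₗ[ℝ] F₃} {X : F₀} {W : FA' →ₗ[ℝ] F₃} {δ₀ θ M c : ℝ}
    (hd : ∀ a b : g.Site, 0 ≤ g.dist a b) (hrow : RowSum g (δ₀ / 8) c) (hθ : 0 ≤ θ) (hM : 0 ≤ M)
    (h : HasMaj₂ bN b₀ b₃ T
      (fun y y'' y' => θ * Real.exp (-(δ₀ / 8 * g.dist y y'')) * Real.exp (-(δ₀ / 4 * g.dist y y'))))
    (hX : ∀ y'', b₀.loc y'' X ≤ M) (hW : ∀ v, W v = T v X) :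
    HasMaj bN b₃ W (fun y y' => b₀.κ * θ * M * c * Real.exp (-(δ₀ / 4 * g.dist y y'))) :=
  h.apply_bounded_exp hd hrow hθ hM le_rfl hX hW

end Literature.MathematicalPhysics.QuantumFieldTheory.Balaban1983to89.B11Ineq189
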